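import Summits.ResolutionOfSingularities.ResolutionOfSingularities.Theorems.WeightedInvariantIota3Sigma
import HarnessLib

/-!
# A two-flag of a regular local ring of dimension `3` extends to a minimal generating triple of `𝔪`

[OURS · L1 W4.3 · DOOR `HypersurfaceCentreConstruction` (stmt-ResolutionOfSingularities-19897) · h8 / (σ-pres)₃: the r.s.p.
completion `hx` = (o70-x) of the registrar's SPEC (Δ12) rev 2 `L/res-L1-w43-plan-1/JSigmaCanon_sketch.lean` (aceffaa8e08fb006,
l.156 `sigmaPresentationLE3Body_of_bodies`); written by res-D-pv-048 (gen 11).  Def-free kernel lemmas; `--supports` the door item as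
a helper.  Folklore commutative algebra (Matsumura, Thm. 2.3: elements of `𝔪` whose residues are linearly independent in `𝔪/𝔪²` are
part of a minimal system of generators), NOT a statement of the manuscript [Hironaka2017]; AI work, weaker than expert review.]

* `Iota3.IsTwoFlag.linearIndependent_toCotangent` — the residues of a two-flag `(g₁, g₂)` in the cotangent space `𝔪/𝔪²` are linearly
  independent (the two-flag clause `a g₁ + b g₂ ∈ 𝔪² ⇒ a, b ∈ 𝔪` read in `𝔪/𝔪²`);
* `Iota3.IsTwoFlag.exists_span_triple_eq_maximalIdeal` — in a Noetherian local ring with `emb dim = 3` a two-flag extends to a minimal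
  generating TRIPLE `𝔪 = (x, g₂, g₁)` (pick `w ∉ span {ḡ₁, ḡ₂}` in the `3`-dimensional cotangent space, lift it, Nakayama via
  `CotangentSpace.span_image_eq_top_iff`);
* **`Iota3.exists_span_triple_of_isTwoFlag`** — the registrar's `hx` VERBATIM: for `S` regular local with `ringKrullDim S = 3`, every
  two-flag extends to `x` with `Ideal.span {x, g₂, g₁} = maximalIdeal S ∧ (maximalIdeal S).spanFinrank = 3`.
-/

set_option linter.dupNamespace false -- mandated namespace of this single-conjunct summit

open IsLocalRing Module

namespace Summit.ResolutionOfSingularities.ResolutionOfSingularities.Cruxes.HypersurfaceCentreConstruction.LocalEngine.Iota3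

universe u

variable {S : Type u} [CommRing S] [IsLocalRing S]

/-- **The residues of a two-flag are linearly independent in the cotangent space `𝔪/𝔪²`.** [cite: Matsumura1987, Thm. 2.3] -/
theorem IsTwoFlag.linearIndependent_toCotangent {g₁ g₂ : S} (h : IsTwoFlag g₁ g₂) :
    LinearIndependent (ResidueField S)
      ![(maximalIdeal S).toCotangent ⟨g₁, h.1⟩, (maximalIdeal S).toCotangent ⟨g₂, h.2.1⟩] := by
  rw [LinearIndependent.pair_iff]
  intro s t hst
  obtain ⟨a, rfl⟩ := Ideal.Quotient.mk_surjective s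
  obtain ⟨b, rfl⟩ := Ideal.Quotient.mk_surjective t
  -- `ā • ḡ₁ + b̄ • ḡ₂ = (a g₁ + b g₂)‾`, which vanishes iff `a g₁ + b g₂ ∈ 𝔪²`
  have h1 : (maximalIdeal S).toCotangent (a • ⟨g₁, h.1⟩ + b • ⟨g₂, h.2.1⟩) = 0 := by
    rw [map_add, map_smul, map_smul]
    exact hst
  rw [Ideal.toCotangent_eq_zero] at h1
  have hmem : a * g₁ + b * g₂ ∈ maximalIdeal S ^ 2 := by
    simpa [Submodule.coe_add, Submodule.coe_smul, smul_eq_mul] using h1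
  obtain ⟨ha, hb⟩ := h.2.2 a b hmem
  exact ⟨Ideal.Quotient.eq_zero_iff_mem.mpr ha, Ideal.Quotient.eq_zero_iff_mem.mpr hb⟩

/-- **A two-flag extends to a minimal generating triple** in a Noetherian local ring of embedding dimension `3`: there is `x` with
`𝔪 = (x, g₂, g₁)` (choose `w` outside the `2`-dimensional span of the residues in the `3`-dimensional cotangent space, lift it to
`x ∈ 𝔪`; the three residues span `𝔪/𝔪²`, so the three elements generate `𝔪` by Nakayama; cf. the `Fin`-indexed family form
`RspExtension.exists_rsp_extension` of …WeightedInvariantRegularParameterExtension). [cite: Matsumura1987, Thm. 2.3] -/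
theorem IsTwoFlag.exists_span_triple_eq_maximalIdeal [IsNoetherianRing S] (h3 : (maximalIdeal S).spanFinrank = 3)
    {g₁ g₂ : S} (h : IsTwoFlag g₁ g₂) : ∃ x : S, Ideal.span {x, g₂, g₁} = maximalIdeal S := by
  classical
  set m := maximalIdeal S with hm
  set v₁ : CotangentSpace S := m.toCotangent ⟨g₁, h.1⟩ with hv₁
  set v₂ : CotangentSpace S := m.toCotangent ⟨g₂, h.2.1⟩ with hv₂
  have hli : LinearIndependent (ResidueField S) ![v₁, v₂] := h.linearIndependent_toCotangent
  have hfin : finrank (ResidueField S) (CotangentSpace S) = 3 := by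
    rw [← spanFinrank_maximalIdeal_eq_finrank_cotangentSpace]
    exact h3
  -- the span of the two residues is a proper subspace (dimension `2 < 3`)
  have hlt : Submodule.span (ResidueField S) (Set.range ![v₁, v₂]) ≠ ⊤ := by
    intro htop
    have h2 := finrank_span_eq_card hli
    rw [htop, finrank_top, hfin] at h2
    simp at h2
  obtain ⟨w, -, hw⟩ := SetLike.exists_of_lt (lt_top_iff_ne_top.mpr hlt)
  -- `(w, ḡ₁, ḡ₂)` is a basis of the cotangent space
  have hli3 : LinearIndependent (ResidueField S) (Fin.cons w ![v₁, v₂] : Fin 3 → CotangentSpace S) :=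
    linearIndependent_finCons.mpr ⟨hli, hw⟩
  have hspan : Submodule.span (ResidueField S) (Set.range (Fin.cons w ![v₁, v₂] : Fin 3 → CotangentSpace S)) = ⊤ :=
    hli3.span_eq_top_of_card_eq_finrank' (by rw [hfin]; simp)
  have hrange : Set.range (Fin.cons w ![v₁, v₂] : Fin 3 → CotangentSpace S) = {w, v₁, v₂} := by
    rw [Fin.range_cons, Matrix.range_cons, Matrix.range_cons, Matrix.range_empty, Set.union_empty,
      Set.singleton_union]
  -- lift `w` to `x ∈ 𝔪`; Nakayama
  obtain ⟨xm, hxm⟩ := m.toCotangent_surjective w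
  have hs : Submodule.span S ({xm, ⟨g₁, h.1⟩, ⟨g₂, h.2.1⟩} : Set m) = ⊤ := by
    rw [← CotangentSpace.span_image_eq_top_iff, Set.image_insert_eq, Set.image_insert_eq, Set.image_singleton, hxm,
      ← hv₁, ← hv₂, ← hrange, hspan]
  refine ⟨(xm : S), ?_⟩
  have hset : m.subtype '' ({xm, ⟨g₁, h.1⟩, ⟨g₂, h.2.1⟩} : Set m) = ({(xm : S), g₂, g₁} : Set S) := by
    rw [Set.image_insert_eq, Set.image_insert_eq, Set.image_singleton, Set.pair_comm g₂ g₁]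
    rfl
  rw [Ideal.span, ← hset, Submodule.span_image, hs, Submodule.map_top, Submodule.range_subtype]

/-- **(o70-x) — the r.s.p. completion `hx` of SPEC (Δ12) `sigmaPresentationLE3Body_of_bodies`, VERBATIM**: in a regular local ring
of dimension `3` (so `emb dim = spanFinrank 𝔪 = 3`) every two-flag `(g₁, g₂)` extends to a minimal generating triple `𝔪 = (x, g₂, g₁)`.
[cite: Matsumura1987, Thm. 2.3 and Thm. 14.2] -/
theorem exists_span_triple_of_isTwoFlag :
    ∀ (S : Type) [CommRing S] [IsRegularLocalRing S], ringKrullDim S = (3 : ℕ) →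
      ∀ g₁ g₂ : S, IsTwoFlag g₁ g₂ → ∃ x : S, Ideal.span {x, g₂, g₁} = maximalIdeal S ∧ (maximalIdeal S).spanFinrank = 3 := by
  intro S _ _ hdim g₁ g₂ h
  have h3 : (maximalIdeal S).spanFinrank = 3 := by
    have h := IsRegularLocalRing.spanFinrank_maximalIdeal (R := S)
    rw [hdim] at h
    exact_mod_cast h
  obtain ⟨x, hx⟩ := h.exists_span_triple_eq_maximalIdeal h3
  exact ⟨x, hx, h3⟩

end Summit.ResolutionOfSingularities.ResolutionOfSingularities.Cruxes.HypersurfaceCentreConstruction.LocalEngine.Iota3
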